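import Summits.BirchSwinnertonDyer.Rank1Residual.X11a.RankZeroHeightFree
import Summits.BirchSwinnertonDyer.Rank1Residual.X11b.MultiplicativeDivisibility

/-!
# Route `ErratumRoadFive` (rung K2a), crux 6 `NonSurjCorner` (item 19065), ENGINE file: the rank-`0`
# Euler-system half `Typed.MissingUpperBoundAt` at a multiplicative prime from a ONE-SIDED cyclotomic
# divisibility — x11c's typed missing input `X11b.MultDivisibilityAt` — with NO image hypothesis
# (cell `bsd-stepL`, seat `bsd-stepL-corner-p1` g4; `--supports stmt-BirchSwinnertonDyer-19065`)

WHY (item 19065 = `Typed.MissingPPartAt W p` on the (T4′) non-surjective corner of class X11b, `p ∈ {5,7}`).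
Every kernel reduction of the corner (g0–g3, `Theorems/ErratumRoadFiveNonSurjCorner*.lean`) consumes the
`p`-part of the rank-`0` Heegner TWIN `E^{d_K}` (an X11a pair with the same non-surjective image,
`not_surj_twist_model`), and the corner's own LOWER half needs only the twin's UPPER half
(`ord_p #Ш(E^d) ≤ ord_p #Ш(E^d)_an`, the KATO direction: g0's binder `hT`). At a multiplicative `p` with an
irreducible NON-surjective image no integral Euler-system bound is in print (Kato 2004 Thm. 17.4 (3) needs
`SL₂(ℤ_p) ⊆ im ρ`; Wuthrich 2014 Prop. 21's constant `C` is supported exactly at such `p`; his Cor. 19 needs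
semistability and no corner curve is semistable), and the cell `b2b-bsdres-x11c` TYPED exactly that missing
input at the pair: `X11b.MultDivisibilityAt W p` (`X11b/MultiplicativeDivisibility.lean`: `X(E/ℚ_∞)` is
`Λ`-torsion and `ϖ·L_p(E,T) = ι(g)` resp. `= ι(T·g)` for SOME `g ∈ char_Λ X` — word for word Kato's ∕
Wuthrich's conclusion without the image hypothesis). Its only consumers so far
(`bsdp_of_multDivisibilityAt_{split,nonsplit}_of_certificate`) need `p ∤ #Ш_an` and a per-pair certificate.
THIS FILE gives the class-level one-sided consumer in rank `0`:

* `le_padicValRat_of_torsionSq_mul_eq`, `missingUpperBoundAt_of_padicValRat_le_rank_zero` — bookkeeping: the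
  inequality twins of `Typed.padicValRat_eq_of_torsionSq_mul_eq` ∕ `bsdp_of_padicValRat_rank_zero`.
* `le_padicValRat_of_{nonsplit,split}_divisibility_rankZero` — from ONE-SIDED divisibility `h = k·g ∈ char X`
  with `ι(h) = ϖ·L` (resp. `ι(T·h) = ϖ·L`), Stein–Wuthrich 2013 Thm. 6.1 in rank `0` (THE §4.2 datum is the
  zero pairing, `RankZeroHeightFree`), the interpolation `L(0) = 2[0]⁺_f` (resp. Greenberg–Stevens +
  `𝓛_p ≠ 0`): `ord_p #Ш + ord_p ∏c_v − 2·ord_p #E(ℚ)_tors ≤ ord_p (L(E,1)/Ω_E)`. The cofactor's constant term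
  `k(0) ∈ ℤ_p` replaces the unit `w(0)` of the EQUALITY engines
  `bsdp_of_multCharIdeal_{nonsplit,split}_rankZero[_heightFree]` (x11a gen 8 ∕ 18), whose proofs are followed
  line by line.
* **`missingUpperBoundAt_of_multDivisibilityAt_of_analyticRank_eq_zero : pubs(SW13 Thm 6.1 ×2, GZK,
  modularity ×2, Greenberg–Stevens) → p ≠ 2 → mult(p) → r_an = 0 → X11b.MultDivisibilityAt W p →
  Typed.MissingUpperBoundAt W p`** — no image hypothesis, no (ram), `p ∣ #Ш_an` allowed; and its X11a form.

The corner file `ErratumRoadFiveNonSurjCornerTwinKato.lean` composes this with g2 ∕ g3. HONEST FRAMING: theorems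
only (no `def`, no named fact minted); CONDITIONAL on the named facts listed as hypotheses; nothing here
proves `MultDivisibilityAt` at any pair; item 19065 does NOT close; no census word moves; BSD is not proved
by any of this.

References: [Kato2004Asterisque] Thm. 17.4; [Wuthrich2014] Thm. 3, Cor. 19, Prop. 21 (pp. 383, 398–400);
[SteinWuthrich2013] Thm. 6.1 (p. 20), §4.2; [GreenbergStevens1993]; [MazurTateTeitelbaum1986] §I.14–15;
[Skinner2016PacificMC] Thm. A (shape); [Miller2011LMS] Def. 1.1; tree: `X11b/MultiplicativeDivisibility.lean`
(x11c gen 5), `X11a/RankZeroHeightFree.lean` (x11a gen 18), `Typed/MultiplicativeRankZero.lean` (x11a gen 8).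
-/


noncomputable section

open scoped Classical MatrixGroups ModularForm

namespace Summit.BirchSwinnertonDyer.Rank1Residual.X11b

open CongruenceSubgroup WeierstrassCurve
  Literature.NumberTheory.EllipticCurves
  Literature.NumberTheory.EllipticCurves.ModularForms
  Literature.NumberTheory.EllipticCurves.Rank1Residual
  Literature.NumberTheory.EllipticCurves.Rank1Residual.Typed
  Literature.NumberTheory.EllipticCurves.Wuthrich2014
  Literature.NumberTheory.EllipticCurves.SteinWuthrich2013
  Summit.BirchSwinnertonDyer.Rank1Residual
  Summit.BirchSwinnertonDyer.Rank1Residual.RankZeroHeightFree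


/-! ### The rank-`0` engine: one-sided cyclotomic divisibility at `p ∥ N` ⟹ `Typed.MissingUpperBoundAt` -/

/-- Valuation bookkeeping, ONE-SIDED: from `t · #E(ℚ)_tors² = v · #Ш[p^∞] · ∏ c_v` in `ℚ_p` with `t ≠ 0` and
`v` of NON-NEGATIVE valuation (an element of `ℤ_p` times a unit), the rank-`0` upper-bound shape
`ord_p #Ш + ord_p ∏ c_v − 2 ord_p #E(ℚ)_tors ≤ ord_p t` (`#Ш ∼ #Ш[p^∞]` up to a `p`-adic unit). The
inequality twin of `Typed.padicValRat_eq_of_torsionSq_mul_eq`. [folklore] -/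
theorem le_padicValRat_of_torsionSq_mul_eq (W : WeierstrassCurve ℚ) [W.IsElliptic] (p : ℕ)
    [Fact p.Prime] [Finite W.sha] {t : ℚ} (ht0 : t ≠ 0) (v : ℚ_[p]) (hv : 0 ≤ v.valuation)
    (key : (t : ℚ_[p]) * (W.torsionOrder : ℚ_[p]) ^ 2 =
      v * (Nat.card (AddCommGroup.primaryComponent W.sha p) : ℚ_[p]) * (W.tamagawaProduct : ℚ_[p])) :
    (padicValNat p W.shaOrder : ℤ) + padicValNat p W.tamagawaProduct -
      2 * padicValNat p W.torsionOrder ≤ padicValRat p t := by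
  have hpP : p.Prime := Fact.out
  haveI : NeZero p := ⟨hpP.ne_zero⟩
  set Shp : ℚ_[p] := (Nat.card (AddCommGroup.primaryComponent W.sha p) : ℚ_[p]) with hShp
  obtain ⟨u₅, hu₅⟩ := exists_unit_natCard_eq_mul_card_primaryComponent W.sha p
  have hSha : (W.shaOrder : ℚ_[p]) = ((u₅ : ℤ_[p]) : ℚ_[p]) * Shp := by
    rw [WeierstrassCurve.shaOrder, hShp]
    exact hu₅
  have htQ0 : (t : ℚ_[p]) ≠ 0 := by exact_mod_cast ht0
  have hT0 : (W.torsionOrder : ℚ_[p]) ≠ 0 := by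
    exact_mod_cast (W.torsionOrder_pos W.finite_torsion_holds).ne'
  have hSha0 : (W.shaOrder : ℚ_[p]) ≠ 0 := by
    exact_mod_cast (WeierstrassCurve.shaOrder_pos W ‹_›).ne'
  have hShp0 : Shp ≠ 0 := by
    intro h0
    rw [h0, mul_zero] at hSha
    exact hSha0 hSha
  have hc0 : (W.tamagawaProduct : ℚ_[p]) ≠ 0 := by
    exact_mod_cast (W.tamagawaProduct_pos_holds : 0 < W.tamagawaProduct).ne'
  have hv0 : v ≠ 0 := by
    intro h0
    rw [h0, zero_mul, zero_mul] at key
    exact (mul_ne_zero htQ0 (pow_ne_zero 2 hT0)) key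
  have key' : (t : ℚ_[p]) * (W.torsionOrder : ℚ_[p]) ^ 2 * ((u₅ : ℤ_[p]) : ℚ_[p]) =
      v * (W.shaOrder : ℚ_[p]) * (W.tamagawaProduct : ℚ_[p]) := by
    rw [hSha]
    linear_combination ((u₅ : ℤ_[p]) : ℚ_[p]) * key
  have hval := congrArg Padic.valuation key'
  rw [Padic.valuation_mul (mul_ne_zero htQ0 (pow_ne_zero 2 hT0)) (coe_units_ne_zero p u₅),
    Padic.valuation_mul htQ0 (pow_ne_zero 2 hT0), Padic.valuation_pow, valuation_coe_units_eq_zero,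
    Padic.valuation_mul (mul_ne_zero hv0 hSha0) hc0, Padic.valuation_mul hv0 hSha0,
    Padic.valuation_ratCast] at hval
  simp only [Padic.valuation_natCast, Nat.cast_ofNat, add_zero] at hval
  linarith

/-- **Packaging: the rank-`0` upper-bound shape is `Typed.MissingUpperBoundAt`.** If `ord_{s=1} L(E,s) = 0`
and `L(E,1)/Ω_E` is a rational `q` with `ord_p #Ш + ord_p ∏ c_ℓ − 2 ord_p #E(ℚ)_tors ≤ ord_p q`, then
`ord_p #Ш ≤ ord_p #Ш_an` with `#Ш_an = q · #E(ℚ)² / ∏ c_ℓ` rational (Gross–Zagier–Kolyvagin `hGZK`: rank `0`,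
`E(ℚ)` finite, `Reg = 1`). The inequality twin of `bsdp_of_padicValRat_rank_zero`.
[cite: Miller2011LMS, Def. 1.1 and §1 (arXiv:1010.2431 p. 3)] -/
theorem missingUpperBoundAt_of_padicValRat_le_rank_zero
    (W : WeierstrassCurve ℚ) [W.IsElliptic] [W.IsGloballyMinimal] (p : ℕ) [Fact p.Prime]
    (hL : W.entireLFunction 1 ≠ 0) (hGZK : rank_eq_analyticRank_of_analyticRank_le_one)
    (hq : ∃ q : ℚ, W.entireLFunction 1 / (W.realPeriodRat : ℂ) = (q : ℂ) ∧
      (padicValNat p W.shaOrder : ℤ) + padicValNat p W.tamagawaProduct -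
        2 * padicValNat p W.torsionOrder ≤ padicValRat p q) :
    Typed.MissingUpperBoundAt W p := by
  obtain ⟨q, hqL, hqv⟩ := hq
  obtain ⟨-, hE, hfin, hsha⟩ := shaAn_eq_of_L_one_div_eq hGZK W hL hqL
  haveI : Finite W.toAffine.Point := hE
  refine ⟨_, hsha, ?_⟩
  have hΩC : (W.realPeriodRat : ℂ) ≠ 0 := Complex.ofReal_ne_zero.mpr W.realPeriodRat_pos_holds.ne'
  have hq0 : q ≠ 0 := by
    rintro rfl
    apply hL
    rw [← div_mul_cancel₀ (W.entireLFunction 1) hΩC, hqL]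
    simp
  have hT : 0 < W.torsionOrder := W.torsionOrder_pos W.finite_torsion_holds
  have hTc : (Nat.card W.toAffine.Point : ℚ) = (W.torsionOrder : ℚ) := by
    rw [W.torsionOrder_eq_natCard_of_finite]
  have hT0 : (Nat.card W.toAffine.Point : ℚ) ≠ 0 := by rw [hTc]; exact_mod_cast hT.ne'
  have hc0 : (W.tamagawaProduct : ℚ) ≠ 0 := by
    exact_mod_cast (W.tamagawaProduct_pos_holds : 0 < W.tamagawaProduct).ne'
  rw [padicValRat.div (mul_ne_zero hq0 (pow_ne_zero 2 hT0)) hc0,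
    padicValRat.mul hq0 (pow_ne_zero 2 hT0), padicValRat.pow, hTc, padicValRat.of_nat,
    padicValRat.of_nat]
  simp only [Nat.cast_ofNat]
  linarith

/-- **Rank `0`, NON-split multiplicative `p ≠ 2`: the UPPER-BOUND shape from ONE-SIDED divisibility.**
Inputs (PUBLISHED named facts or tree theorems): Stein–Wuthrich 2013 Thm. 6.1 at a non-split prime (`hJ`;
THE §4.2 datum is the zero pairing in rank `0`, `RankZeroHeightFree.exists_isMultCanonical_of_finite`),
Gross–Zagier–Kolyvagin (`hGZK`), modularity (`hmod`); data: Tate parameter `q`, cyclotomic `(κ, γ)`, newform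
`f`, dual datum `D` with `X` torsion (`hX`), period ratio `ϖ ≠ 0`, THE non-split `p`-adic `L`-function `L`;
and the DIVISIBILITY `hdiv`: some `h ∈ char_Λ X` with `ι(h) = ϖ · L` (Kato's shape; no unit asked). Chain:
`char_Λ X = (g)` (principal, `charIdeal_isPrincipal_holds`), `h = k·g`, `k(0)·g(0) = ϖ·L(0) = 2ϖ[0]⁺_f`;
Thm. 6.1 clause 3 in rank `0`: `g(0)·#E(ℚ)_tors² = u·2·#Ш[p^∞]·∏c_v`; hence
`(L(E,1)/Ω_E)·#E(ℚ)_tors² = (u·k(0))·#Ш[p^∞]·∏c_v` with `k(0) ∈ ℤ_p`, and valuations.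
-- adapted from Summits/BirchSwinnertonDyer/Rank1Residual/X11a/RankZeroHeightFree.lean
[cite: SteinWuthrich2013, Thm. 6.1 (p. 20) and §4.2 (p. 15)] [cite: MazurTateTeitelbaum1986, §I.14]
[cite: GreenbergLNM1716, §4 (PDF p. 113)] [cite: Miller2011LMS, §1] -/
theorem le_padicValRat_of_nonsplit_divisibility_rankZero (hJ : thm61_nonsplitMultiplicative)
    (hGZK : rank_eq_analyticRank_of_analyticRank_le_one) (hmod : hasEntireLFunction_rat)
    (W : WeierstrassCurve ℚ) [W.IsElliptic] [W.IsGloballyMinimal] (p : ℕ) [Fact p.Prime]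
    {κ : ZpExtension ℚ p} {γ : Field.absoluteGaloisGroup ℚ} {N : ℕ} [NeZero N]
    {f : CuspForm (Gamma0 N) 2} (hp : p ≠ 2) (hr : W.analyticRank = 0)
    (hmult : W.HasMultiplicativeReductionAtPrime p)
    (hns : ¬ W.HasSplitMultiplicativeReductionAtPrime p)
    {q : ℚ_[p]} (hq0 : q ≠ 0) (hq1 : ‖q‖ < 1) (hqj : tateJ q = (W.j : ℚ_[p]))
    (hκ : κ.IsCyclotomic) (hγ : κ.IsTopGenerator γ) (hγ' : IsCyclotomicVariable p γ)
    (hf : IsNewformOf W f) (D : W.SelmerDualData κ γ) (ϖ : ℚ) (hϖ0 : ϖ ≠ 0)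
    (hϖ : (ϖ : ℝ) * W.realPeriodRat = plusPeriod f)
    (L : PowerSeries ℚ_[p]) (hL : IsMultPAdicLFunctionOf f p (-1) L) (hX : D.IsTorsion)
    (hdiv : ∃ h ∈ D.charIdeal, iwasawaToPowerSeries p h = PowerSeries.C ((ϖ : ℚ) : ℚ_[p]) * L) :
    ∃ t : ℚ, W.entireLFunction 1 / (W.realPeriodRat : ℂ) = (t : ℂ) ∧
      (padicValNat p W.shaOrder : ℤ) + padicValNat p W.tamagawaProduct -
        2 * padicValNat p W.torsionOrder ≤ padicValRat p t := by
  have hpP : p.Prime := Fact.out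
  haveI : Module.Finite (IwasawaAlgebra p) D.X := D.module_finite_holds hγ
  obtain ⟨h, hh, hι⟩ := hdiv
  -- a generator of the (principal) characteristic ideal, and the cofactor `k` with `k·g = h`
  obtain ⟨g, hg⟩ := (charIdeal_isPrincipal_holds p D.X).principal
  have hchar : D.charIdeal = Ideal.span {g} := hg
  rw [hchar] at hh
  obtain ⟨k, hkg⟩ := Ideal.mem_span_singleton'.mp hh
  -- `L(E,1) ≠ 0`, rank `0`, `Ш` finite, `E(ℚ)` finite
  have hL1 : W.entireLFunction 1 ≠ 0 := (W.analyticRank_eq_zero_iff_holds (hmod W)).1 hr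
  obtain ⟨hrank, hfin⟩ := hGZK W (by omega)
  have hr0 : W.mordellWeilRank = 0 := by rw [hrank, hr]
  haveI : Finite W.toAffine.Point := W.mordellWeilRank_eq_zero_iff_finite.mp hr0
  haveI : Finite W.sha := hfin
  haveI : Finite (AddCommGroup.primaryComponent W.sha p) := inferInstance
  -- the rational `t = ϖ · [0]⁺_f = L(E,1)/Ω_E`
  set s : ℚ := ratPlusSymbol f 0 with hs_def
  set t : ℚ := ϖ * s with ht_def
  have hΩpos : 0 < W.realPeriodRat := W.realPeriodRat_pos_holds
  have hLval : W.entireLFunction 1 = (((s : ℝ) * plusPeriod f : ℝ) : ℂ) := hf.entireLFunction_one_eq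
  have hq : W.entireLFunction 1 / (W.realPeriodRat : ℂ) = ((t : ℚ) : ℂ) := by
    rw [hLval, ← hϖ, div_eq_iff (Complex.ofReal_ne_zero.mpr hΩpos.ne'), ht_def]
    push_cast
    ring
  have hs0 : s ≠ 0 := by
    intro h0
    apply hL1
    rw [hLval, h0]
    simp
  have ht0 : t ≠ 0 := mul_ne_zero hϖ0 hs0
  -- THE height datum IS the zero pairing in rank `0`; `Reg_p = 1`
  obtain ⟨Dh, hDh⟩ := exists_isMultCanonical_of_finite W p q
  have hReg : padicRegulator Dh = 1 := padicRegulator_eq_one_of_finite W p Dh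
  have hSch : SchneiderConjecture Dh := by
    rw [SchneiderConjecture, hReg]
    exact one_ne_zero
  -- Stein–Wuthrich Thm. 6.1, clause 3, in rank `0`
  obtain ⟨-, -, h3⟩ := hJ W p hp hmult hns q hq0 hq1 hqj κ γ hκ hγ hγ' D hX g hchar Dh hDh
  obtain ⟨u, hu⟩ := h3 hSch inferInstance
  simp only [hr0, pow_zero, mul_one, hReg, PowerSeries.coeff_zero_eq_constantCoeff] at hu
  -- constant coefficients of `ι(k · g) = ϖ · L`: `k(0) · g(0) = ϖ · 2 [0]⁺_f`
  have hL0 : PowerSeries.constantCoeff L = 2 * (s : ℚ_[p]) := hL.constantCoeff_of_neg_one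
  have hkg' : PowerSeries.constantCoeff (k * g) =
      PowerSeries.constantCoeff k * PowerSeries.constantCoeff g := map_mul _ _ _
  have h0 := congrArg PowerSeries.constantCoeff hι
  rw [← hkg, constantCoeff_iwasawaToPowerSeries, hkg', PadicInt.coe_mul, map_mul,
    PowerSeries.constantCoeff_C, hL0] at h0
  -- the cofactor's constant term is a `p`-adic INTEGER (not necessarily a unit)
  set k0 : ℚ_[p] := ((PowerSeries.constantCoeff k : ℤ_[p]) : ℚ_[p]) with hk0_def
  have hk0v : 0 ≤ k0.valuation := PadicInt.valuation_coe_nonneg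
  have htcast : ((t : ℚ) : ℚ_[p]) = (ϖ : ℚ_[p]) * (s : ℚ_[p]) := by
    rw [ht_def]; push_cast; ring
  -- the identity `t · #tors² = (u · k0) · #Ш[p^∞] · ∏ c_v`
  have key : (t : ℚ_[p]) * (W.torsionOrder : ℚ_[p]) ^ 2 =
      (((u : ℤ_[p]) : ℚ_[p]) * k0) *
        (Nat.card (AddCommGroup.primaryComponent W.sha p) : ℚ_[p]) * (W.tamagawaProduct : ℚ_[p]) := by
    apply mul_left_cancel₀ (two_ne_zero : (2 : ℚ_[p]) ≠ 0)
    rw [htcast, hk0_def]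
    linear_combination ((PowerSeries.constantCoeff k : ℤ_[p]) : ℚ_[p]) * hu -
      (W.torsionOrder : ℚ_[p]) ^ 2 * h0
  have hv : 0 ≤ (((u : ℤ_[p]) : ℚ_[p]) * k0).valuation := by
    by_cases hk : k0 = 0
    · rw [hk, mul_zero, Padic.valuation_zero]
    · rw [Padic.valuation_mul (coe_units_ne_zero p u) hk, valuation_coe_units_eq_zero, zero_add]
      exact hk0v
  exact ⟨t, hq, le_padicValRat_of_torsionSq_mul_eq W p ht0 _ hv key⟩

/-- **Rank `0`, SPLIT multiplicative `p ≠ 2`: the UPPER-BOUND shape from ONE-SIDED divisibility.** As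
`le_padicValRat_of_nonsplit_divisibility_rankZero` with the Tate-parameter datum `Dq`, Stein–Wuthrich Thm. 6.1
at a split prime (`hJ`; zero datum `RankZeroHeightFree.exists_isSplitMultCanonical_of_finite`),
Greenberg–Stevens (`hGS`: `[T¹]L · log_p κ(γ) = 𝓛_p · [0]⁺_f`), `𝓛_p ≠ 0` (`h𝓛`), and the DIVISIBILITY `hdiv`
in the split shape: some `h ∈ char_Λ X` with `ι(T · h) = ϖ · L`. Chain: `h = k·g`,
`[T¹]ι(T·k·g) = k(0)·g(0) = ϖ·[T¹]L`, so `k(0)·g(0)·log κ(γ) = 𝓛_p·ϖ[0]⁺_f`; Thm. 6.1 clause 3 in rank `0`: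
`g(0)·log κ(γ)·#E(ℚ)_tors² = u·𝓛_p·#Ш[p^∞]·∏c_v`; cancel `𝓛_p`.
-- adapted from Summits/BirchSwinnertonDyer/Rank1Residual/X11a/RankZeroHeightFree.lean
[cite: SteinWuthrich2013, Thm. 6.1 (p. 20) and §4.2 (pp. 15–16)]
[cite: GreenbergStevens1993, Thm. (trivial zero)] [cite: MazurTateTeitelbaum1986, §I.14–I.15]
[cite: Miller2011LMS, §1] -/
theorem le_padicValRat_of_split_divisibility_rankZero (hJ : thm61_splitMultiplicative)
    (hGZK : rank_eq_analyticRank_of_analyticRank_le_one) (hmod : hasEntireLFunction_rat)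
    (W : WeierstrassCurve ℚ) [W.IsElliptic] [W.IsGloballyMinimal] (p : ℕ) [Fact p.Prime]
    (hGS : greenberg_stevens (W := W) (p := p)) (h𝓛 : LInvariant_ne_zero (W := W) (p := p))
    {κ : ZpExtension ℚ p} {γ : Field.absoluteGaloisGroup ℚ} {N : ℕ} [NeZero N]
    {f : CuspForm (Gamma0 N) 2} (hp : p ≠ 2) (hr : W.analyticRank = 0)
    (Dq : TateParameterData W p)
    (hκ : κ.IsCyclotomic) (hγ : κ.IsTopGenerator γ) (hγ' : IsCyclotomicVariable p γ)
    (hf : IsNewformOf W f) (D : W.SelmerDualData κ γ) (ϖ : ℚ) (hϖ0 : ϖ ≠ 0)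
    (hϖ : (ϖ : ℝ) * W.realPeriodRat = plusPeriod f)
    (L : PowerSeries ℚ_[p]) (hL : IsSplitMultPAdicLFunctionOf f p L) (hX : D.IsTorsion)
    (hdiv : ∃ h ∈ D.charIdeal,
      iwasawaToPowerSeries p ((PowerSeries.X : IwasawaAlgebra p) * h) = PowerSeries.C ((ϖ : ℚ) : ℚ_[p]) * L) :
    ∃ t : ℚ, W.entireLFunction 1 / (W.realPeriodRat : ℂ) = (t : ℂ) ∧
      (padicValNat p W.shaOrder : ℤ) + padicValNat p W.tamagawaProduct -
        2 * padicValNat p W.torsionOrder ≤ padicValRat p t := by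
  have hpP : p.Prime := Fact.out
  haveI : Module.Finite (IwasawaAlgebra p) D.X := D.module_finite_holds hγ
  obtain ⟨h, hh, hι⟩ := hdiv
  obtain ⟨g, hg⟩ := (charIdeal_isPrincipal_holds p D.X).principal
  have hchar : D.charIdeal = Ideal.span {g} := hg
  rw [hchar] at hh
  obtain ⟨k, hkg⟩ := Ideal.mem_span_singleton'.mp hh
  have hL1 : W.entireLFunction 1 ≠ 0 := (W.analyticRank_eq_zero_iff_holds (hmod W)).1 hr
  obtain ⟨hrank, hfin⟩ := hGZK W (by omega)
  have hr0 : W.mordellWeilRank = 0 := by rw [hrank, hr]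
  haveI : Finite W.toAffine.Point := W.mordellWeilRank_eq_zero_iff_finite.mp hr0
  haveI : Finite W.sha := hfin
  haveI : Finite (AddCommGroup.primaryComponent W.sha p) := inferInstance
  set s : ℚ := ratPlusSymbol f 0 with hs_def
  set t : ℚ := ϖ * s with ht_def
  have hΩpos : 0 < W.realPeriodRat := W.realPeriodRat_pos_holds
  have hLval : W.entireLFunction 1 = (((s : ℝ) * plusPeriod f : ℝ) : ℂ) := hf.entireLFunction_one_eq
  have hq : W.entireLFunction 1 / (W.realPeriodRat : ℂ) = ((t : ℚ) : ℂ) := by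
    rw [hLval, ← hϖ, div_eq_iff (Complex.ofReal_ne_zero.mpr hΩpos.ne'), ht_def]
    push_cast
    ring
  have hs0 : s ≠ 0 := by
    intro h0
    apply hL1
    rw [hLval, h0]
    simp
  have ht0 : t ≠ 0 := mul_ne_zero hϖ0 hs0
  -- THE height datum at the split prime IS the zero pairing in rank `0`; `Reg_p = 1`
  obtain ⟨Dh, hDh⟩ := exists_isSplitMultCanonical_of_finite W p Dq
  have hReg : padicRegulator Dh = 1 := padicRegulator_eq_one_of_finite W p Dh
  have hSch : SchneiderConjecture Dh := by
    rw [SchneiderConjecture, hReg]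
    exact one_ne_zero
  -- Stein–Wuthrich Thm. 6.1 (split), clause 3, in rank `0`
  obtain ⟨-, -, h3⟩ := hJ W p hp Dq κ γ hκ hγ hγ' D hX g hchar Dh hDh
  obtain ⟨u, hu⟩ := h3 hSch inferInstance
  simp only [hr0, zero_add, pow_one, hReg, mul_one, PowerSeries.coeff_zero_eq_constantCoeff] at hu
  -- Greenberg–Stevens: `[T¹]L · log = 𝓛 · [0]⁺_f`
  obtain ⟨-, hGS1⟩ := hGS Dq hf hL
  -- `[T¹] ι(T·k·g) = k(0)·g(0)`
  have hkg' : PowerSeries.constantCoeff (k * g) =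
      PowerSeries.constantCoeff k * PowerSeries.constantCoeff g := map_mul _ _ _
  have h1 : ((PowerSeries.constantCoeff k : ℤ_[p]) : ℚ_[p]) *
      ((PowerSeries.constantCoeff g : ℤ_[p]) : ℚ_[p]) =
        ((ϖ : ℚ) : ℚ_[p]) * PowerSeries.coeff 1 L := by
    have h := congrArg (PowerSeries.coeff 1) hι
    rw [← hkg] at h
    rw [iwasawaToPowerSeries, PowerSeries.coeff_map, PowerSeries.coeff_succ_X_mul,
      PowerSeries.coeff_zero_eq_constantCoeff, hkg', PowerSeries.coeff_C_mul, map_mul] at h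
    exact h
  set k0 : ℚ_[p] := ((PowerSeries.constantCoeff k : ℤ_[p]) : ℚ_[p]) with hk0_def
  have hk0v : 0 ≤ k0.valuation := PadicInt.valuation_coe_nonneg
  have htcast : ((t : ℚ) : ℚ_[p]) = (ϖ : ℚ_[p]) * (s : ℚ_[p]) := by
    rw [ht_def]; push_cast; ring
  have h𝓛0 : LInvariant Dq ≠ 0 := h𝓛 Dq
  -- the identity `t · #tors² = (u · k0) · #Ш[p^∞] · ∏ c_v`
  have key : (t : ℚ_[p]) * (W.torsionOrder : ℚ_[p]) ^ 2 =
      (((u : ℤ_[p]) : ℚ_[p]) * k0) *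
        (Nat.card (AddCommGroup.primaryComponent W.sha p) : ℚ_[p]) * (W.tamagawaProduct : ℚ_[p]) := by
    apply mul_left_cancel₀ h𝓛0
    rw [htcast, hk0_def]
    linear_combination (-(((ϖ : ℚ) : ℚ_[p]) * (W.torsionOrder : ℚ_[p]) ^ 2)) * hGS1 -
      (padicLog p (cyclotomicGenerator p) * (W.torsionOrder : ℚ_[p]) ^ 2) * h1 +
      ((PowerSeries.constantCoeff k : ℤ_[p]) : ℚ_[p]) * hu
  have hv : 0 ≤ (((u : ℤ_[p]) : ℚ_[p]) * k0).valuation := by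
    by_cases hk : k0 = 0
    · rw [hk, mul_zero, Padic.valuation_zero]
    · rw [Padic.valuation_mul (coe_units_ne_zero p u) hk, valuation_coe_units_eq_zero, zero_add]
      exact hk0v
  exact ⟨t, hq, le_padicValRat_of_torsionSq_mul_eq W p ht0 _ hv key⟩

/-- **The rank-`0` engine: x11c's typed divisibility at the pair gives the Euler-system half.** For every
globally minimal elliptic `W/ℚ`, every ODD prime `p` of multiplicative reduction with `ord_{s=1} L(E,s) = 0`:
`X11b.MultDivisibilityAt W p ⟹ Typed.MissingUpperBoundAt W p` (`ord_p #Ш ≤ ord_p #Ш_an`), granted the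
PUBLISHED named facts Stein–Wuthrich 2013 Thm. 6.1 (`hJs`/`hJn`), Gross–Zagier–Kolyvagin (`hGZK`), modularity
(`hmod`, `hpar`) and Greenberg–Stevens (`hGS`); `𝓛_p ≠ 0` is the tree THEOREM `LInvariant_ne_zero_holds`. Data
instantiated from tree theorems (cyclotomic `(κ, γ)`, `X(E/ℚ_∞)`, the newform and `ϖ > 0` of a modular
parametrisation, THE Mazur–Tate–Teitelbaum function, the Tate parameter). NO hypothesis on the image of
`ρ̄_{E,p}`, no (ram) prime, `p ∣ #Ш_an` allowed — the one-sided companion of the X11a cell's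
`X2.bsdp_of_mazurMainConjectureAt_of_analyticRank_eq_zero_heightFree` (EQUALITY ⟹ `BSD(E,p)`).
[cite: SteinWuthrich2013, Thm. 6.1 (p. 20) and §4.2] [cite: GreenbergStevens1993, Thm. (trivial zero)]
[cite: Wuthrich2014, Thm. 3 (p. 383) and Cor. 19 (p. 398) (shape of the divisibility)]
[cite: Miller2011LMS, Def. 1.1 and §1] -/
theorem missingUpperBoundAt_of_multDivisibilityAt_of_analyticRank_eq_zero
    (hJs : thm61_splitMultiplicative) (hJn : thm61_nonsplitMultiplicative)
    (hGZK : rank_eq_analyticRank_of_analyticRank_le_one) (hmod : hasEntireLFunction_rat)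
    (hpar : nonempty_modularParametrizationData)
    (W : WeierstrassCurve ℚ) [W.IsElliptic] [W.IsGloballyMinimal] (p : ℕ) [Fact p.Prime]
    (hGS : greenberg_stevens (W := W) (p := p))
    (hp : p ≠ 2) (hmult : W.HasMultiplicativeReductionAtPrime p) (hr : W.analyticRank = 0)
    (hdiv : MultDivisibilityAt W p) : Typed.MissingUpperBoundAt W p := by
  obtain ⟨κ, hκ, γ, hγ, hγ'⟩ := exists_isCyclotomic_isTopGenerator_isCyclotomicVariable_holds p
  obtain ⟨D⟩ := W.nonempty_selmerDualData_holds κ γ hγ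
  haveI : NeZero (W.conductorNorm ℤ) := ⟨(W.conductorNorm_pos_holds).ne'⟩
  obtain ⟨Dm⟩ := hpar W
  obtain ⟨ϖ, hϖpos, hϖ, -⟩ := Dm.exists_rat_mul_realPeriodRat_eq_plusPeriod
  obtain ⟨hX, hnsp, hsp⟩ := hdiv hκ hγ hγ' Dm.isNewformOf D ϖ hϖpos.ne' hϖ
  have hL1 : W.entireLFunction 1 ≠ 0 := (W.analyticRank_eq_zero_iff_holds (hmod W)).1 hr
  by_cases hsplit : W.HasSplitMultiplicativeReductionAtPrime p
  · obtain ⟨L, hL⟩ := exists_isSplitMultPAdicLFunctionOf hsplit Dm.isNewformOf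
    obtain ⟨Dq⟩ := (nonempty_tateParameterData_iff_holds (W := W) (p := p)).mpr hsplit
    exact missingUpperBoundAt_of_padicValRat_le_rank_zero W p hL1 hGZK
      (le_padicValRat_of_split_divisibility_rankZero hJs hGZK hmod W p hGS LInvariant_ne_zero_holds hp hr
        Dq hκ hγ hγ' Dm.isNewformOf D ϖ hϖpos.ne' hϖ L hL hX (hsp hsplit L hL))
  · obtain ⟨L, hL⟩ := exists_isMultPAdicLFunctionOf_neg_one_of_nonsplit Dm.isNewformOf hmult hsplit
    obtain ⟨q, ⟨hq0, hq1, hqj⟩, -⟩ := existsUnique_tateJ_eq_of_one_lt_norm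
      (one_lt_norm_j_of_hasMultiplicativeReductionAtPrime (W := W) (p := p) hmult)
    exact missingUpperBoundAt_of_padicValRat_le_rank_zero W p hL1 hGZK
      (le_padicValRat_of_nonsplit_divisibility_rankZero hJn hGZK hmod W p hp hr hmult hsplit hq0 hq1 hqj
        hκ hγ hγ' Dm.isNewformOf D ϖ hϖpos.ne' hϖ L hL hX (hnsp hsplit L hL))

/-- **On class X11a** (`r_an = 0 ∧ p ≠ 2 ∧ mult ∧ irr ∧ ¬ram`; any image): the typed divisibility at the pair
gives the Euler-system half. [cite: SteinWuthrich2013, Thm. 6.1 (p. 20)] [cite: Miller2011LMS, Def. 1.1] -/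
theorem missingUpperBoundAt_of_classX11a_of_multDivisibilityAt
    (hJs : thm61_splitMultiplicative) (hJn : thm61_nonsplitMultiplicative)
    (hGZK : rank_eq_analyticRank_of_analyticRank_le_one) (hmod : hasEntireLFunction_rat)
    (hpar : nonempty_modularParametrizationData)
    (Wd : WeierstrassCurve ℚ) [Wd.IsElliptic] [Wd.IsGloballyMinimal] (p : ℕ) [Fact p.Prime]
    (hGS : greenberg_stevens (W := Wd) (p := p))
    (hXa : ClassX11a Wd p) (hdiv : MultDivisibilityAt Wd p) : Typed.MissingUpperBoundAt Wd p :=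
  missingUpperBoundAt_of_multDivisibilityAt_of_analyticRank_eq_zero hJs hJn hGZK hmod hpar Wd p hGS hXa.2.1
    hXa.2.2.1 hXa.1 hdiv

end Summit.BirchSwinnertonDyer.Rank1Residual.X11b

end
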